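import Literature.AlgebraicGeometry.HodgeTheory.FermatOddMiddleBettiNumber
import HarnessLib

/-!
# The number of admissible Fermat characters in closed form, and the middle Betti number of a smooth hypersurface:
# `d · |𝔄ⁿ_d| = (d−1)ⁿ⁺² + (−1)ⁿ⁺²(d−1)` (Shioda 1979 §1; Eisenbud–Harris Ex. 5.24)

Family `hodge`, layer `Literature/AlgebraicGeometry/HodgeTheory`. PROOF FILE (theorems only: no definition, no named
fact; D-0026 net debt `0`). The tree counts `|𝔄ⁿ_d| = #{α ∈ (ℤ/d ∖ 0)ⁿ⁺² : Σ αᵢ = 0}` through the recursion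
`N_{k+1} + N_k = (d−1)^k` (`card_fermatAdmissible_succ_add`); solving it gives the CLOSED FORM
`d · N_k = (d−1)^k + (−1)^k (d−1)`, whence — through `b₂ᵣ(X_F) = |𝔄| + 1` (`finrank_bettiCohomology_middle_hypersurface_even`)
and `b₂ₚ₊₁(X_F) = |𝔄|` (`finrank_bettiCohomology_middle_hypersurface_odd`) — the textbook middle Betti number of a smooth
hypersurface of degree `d` and dimension `n` in `ℙⁿ⁺¹`: `bₙ = ((d−1)ⁿ⁺² + (−1)ⁿ(d−1))/d + [n even]` (D. Eisenbud,
J. Harris, *3264 and All That*, Example 5.24: "`χ_top(X) = Σ (−1)^i C(n+1, n−1−i) d^{i+1}` … the Euler characteristic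
determines the middle Betti number").

* `mul_card_fermatAdmissible_even` ∕ `_odd` — `d · N_{2k} = (d−1)^{2k} + (d−1)`, `d · N_{2k+1} + (d−1) = (d−1)^{2k+1}`.
* `mul_finrank_bettiCohomology_middle_hypersurface_odd` — `d · b₂ₚ₊₁(X_F) + (d−1) = (d−1)^{2p+3}` (`p ≥ 1`).
* `mul_finrank_bettiCohomology_middle_hypersurface_even` — `d · b₂ᵣ(X_F) = (d−1)^{2r+2} + (d−1) + d` (`r ≥ 1`).

Written by the prover seat `hodge-nonav-19716-p2` (g5, cell `hodge-nonav`).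

## References

* [Shioda1979HodgeFermat] T. Shioda, The Hodge conjecture for Fermat varieties, Math. Ann. 245 (1979), §1 (1.3)–(1.4).
* [EisenbudHarris2016] D. Eisenbud, J. Harris, 3264 and All That, CUP 2016, §5.7 Example 5.24 and Table 5.1.
-/

noncomputable section

open CategoryTheory AlgebraicGeometry

namespace Literature.AlgebraicGeometry.HodgeTheory

open Literature.AlgebraicGeometry.Motives

variable (m : ℕ)

/-- **`d · N_{2k} = (d−1)^{2k} + (d−1)` and `d · N_{2k+1} + (d−1) = (d−1)^{2k+1}`** (both at once, by induction on `k`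
from `N_{j+1} + N_j = (d−1)^j`; `N_0 = 1`). [cite: Shioda1979HodgeFermat, §1 (1.3)–(1.4)] -/
theorem mul_card_fermatAdmissible_even_and_odd [NeZero m] (k : ℕ) :
    m * Fintype.card {α : Fin (2 * k) → ZMod m // (∀ i, α i ≠ 0) ∧ ∑ i, α i = 0} = (m - 1) ^ (2 * k) + (m - 1) ∧
    m * Fintype.card {α : Fin (2 * k + 1) → ZMod m // (∀ i, α i ≠ 0) ∧ ∑ i, α i = 0} + (m - 1) =
      (m - 1) ^ (2 * k + 1) := by
  have hm : 1 ≤ m := NeZero.one_le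
  induction k with
  | zero =>
    have h0 : Fintype.card {α : Fin (2 * 0) → ZMod m // (∀ i, α i ≠ 0) ∧ ∑ i, α i = 0} = 1 := by
      rw [Fintype.card_eq_one_iff]
      refine ⟨⟨fun i ↦ Fin.elim0 (by simpa using i), fun i ↦ Fin.elim0 (by simpa using i), by simp⟩, fun α ↦ ?_⟩
      ext i; exact Fin.elim0 (by simpa using i)
    have h1 : Fintype.card {α : Fin (2 * 0 + 1) → ZMod m // (∀ i, α i ≠ 0) ∧ ∑ i, α i = 0} +
        Fintype.card {α : Fin (2 * 0) → ZMod m // (∀ i, α i ≠ 0) ∧ ∑ i, α i = 0} = (m - 1) ^ (2 * 0) :=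
      card_fermatAdmissible_succ_add m (2 * 0)
    have hpow : (m - 1) ^ (2 * 0) = 1 := by norm_num
    rw [h0, hpow] at h1
    have hc1 : Fintype.card {α : Fin (2 * 0 + 1) → ZMod m // (∀ i, α i ≠ 0) ∧ ∑ i, α i = 0} = 0 := by omega
    rw [h0, hc1, hpow]
    constructor
    · omega
    · simp only [Nat.mul_zero, Nat.zero_add, pow_one]
  | succ k ih =>
    obtain ⟨ihe, iho⟩ := ih
    have h1 : Fintype.card {α : Fin (2 * k + 1 + 1) → ZMod m // (∀ i, α i ≠ 0) ∧ ∑ i, α i = 0} +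
        Fintype.card {α : Fin (2 * k + 1) → ZMod m // (∀ i, α i ≠ 0) ∧ ∑ i, α i = 0} = (m - 1) ^ (2 * k + 1) :=
      card_fermatAdmissible_succ_add m (2 * k + 1)
    have h2 : Fintype.card {α : Fin (2 * k + 1 + 1 + 1) → ZMod m // (∀ i, α i ≠ 0) ∧ ∑ i, α i = 0} +
        Fintype.card {α : Fin (2 * k + 1 + 1) → ZMod m // (∀ i, α i ≠ 0) ∧ ∑ i, α i = 0} = (m - 1) ^ (2 * k + 1 + 1) :=
      card_fermatAdmissible_succ_add m (2 * k + 1 + 1)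
    have he : Fintype.card {α : Fin (2 * (k + 1)) → ZMod m // (∀ i, α i ≠ 0) ∧ ∑ i, α i = 0} =
        Fintype.card {α : Fin (2 * k + 1 + 1) → ZMod m // (∀ i, α i ≠ 0) ∧ ∑ i, α i = 0} := rfl
    have ho : Fintype.card {α : Fin (2 * (k + 1) + 1) → ZMod m // (∀ i, α i ≠ 0) ∧ ∑ i, α i = 0} =
        Fintype.card {α : Fin (2 * k + 1 + 1 + 1) → ZMod m // (∀ i, α i ≠ 0) ∧ ∑ i, α i = 0} := rfl
    rw [he, ho]
    have hp1 : (m - 1) ^ (2 * (k + 1)) = (m - 1) ^ (2 * k + 1) * (m - 1) := by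
      rw [show 2 * (k + 1) = 2 * k + 1 + 1 by ring, pow_succ]
    have hp2 : (m - 1) ^ (2 * (k + 1) + 1) = (m - 1) ^ (2 * k + 1) * (m - 1) * (m - 1) := by
      rw [show 2 * (k + 1) + 1 = 2 * k + 1 + 1 + 1 by ring, pow_succ, pow_succ]
    have hp3 : (m - 1) ^ (2 * k + 1 + 1) = (m - 1) ^ (2 * k + 1) * (m - 1) := pow_succ _ _
    rw [hp1, hp2]
    rw [hp3] at h2
    set A := Fintype.card {α : Fin (2 * k + 1) → ZMod m // (∀ i, α i ≠ 0) ∧ ∑ i, α i = 0}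
    set B := Fintype.card {α : Fin (2 * k + 1 + 1) → ZMod m // (∀ i, α i ≠ 0) ∧ ∑ i, α i = 0}
    set C := Fintype.card {α : Fin (2 * k + 1 + 1 + 1) → ZMod m // (∀ i, α i ≠ 0) ∧ ∑ i, α i = 0}
    set P := (m - 1) ^ (2 * k + 1)
    obtain ⟨t, rfl⟩ : ∃ t, m = t + 1 := ⟨m - 1, by omega⟩
    simp only [Nat.add_sub_cancel] at iho h1 h2 ⊢
    -- `(t+1) B = (t+1) P − (t+1) A = (t+1) P − (P − t) = t P + t`, `(t+1) C + t = (t+1) P t − (t+1) B + t = P t²`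
    have hB : (t + 1) * B = P * t + t := by nlinarith [iho, h1]
    refine ⟨hB, ?_⟩
    nlinarith [hB, h2]

/-- **`d · |𝔄²ᵖ⁺¹_d| + (d−1) = (d−1)^{2p+3}`** (odd dimension, `2p + 3` coordinates). [cite: Shioda1979HodgeFermat, §1 (1.3)–(1.4)] -/
theorem mul_card_fermatAdmissible_odd [NeZero m] (p : ℕ) :
    m * Fintype.card {α : Fin (2 * p + 3) → ZMod m // (∀ i, α i ≠ 0) ∧ ∑ i, α i = 0} + (m - 1) =
      (m - 1) ^ (2 * p + 3) :=
  (mul_card_fermatAdmissible_even_and_odd m (p + 1)).2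

/-- **`d · |𝔄²ʳ_d| = (d−1)^{2r+2} + (d−1)`** (even dimension, `2r + 2` coordinates). [cite: Shioda1979HodgeFermat, §1 (1.3)–(1.4)] -/
theorem mul_card_fermatAdmissible_even [NeZero m] (r : ℕ) :
    m * Fintype.card {α : Fin (2 * r + 2) → ZMod m // (∀ i, α i ≠ 0) ∧ ∑ i, α i = 0} =
      (m - 1) ^ (2 * r + 2) + (m - 1) :=
  (mul_card_fermatAdmissible_even_and_odd m (r + 1)).1

variable {m}

/-- **The middle Betti number of a smooth ODD-dimensional hypersurface in closed form**: for a nonsingular form `F` of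
degree `d ≥ 1` in `2p + 3` variables (`p ≥ 1`), `d · b₂ₚ₊₁(X_F) + (d−1) = (d−1)^{2p+3}`, i.e.
`b₂ₚ₊₁ = ((d−1)^{2p+3} − (d−1))/d`. [cite: EisenbudHarris2016, Example 5.24] [cite: Shioda1979HodgeFermat, §1 (1.3)–(1.4)] -/
theorem mul_finrank_bettiCohomology_middle_hypersurface_odd {d : ℕ} [NeZero d] {p : ℕ} (hp : 1 ≤ p)
    (F : MvPolynomial (Fin (2 * p + 1 + 2)) ℂ) (hF : F.IsHomogeneous d)
    (hFns : SmoothHypersurface.IsNonsingularForm ℂ F) :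
    d * Module.finrank ℚ (bettiCohomology (SmoothHypersurface.hypersurface F) (2 * p + 1)) + (d - 1) =
      (d - 1) ^ (2 * p + 3) := by
  rw [finrank_bettiCohomology_middle_hypersurface_odd hp F hF hFns]
  exact mul_card_fermatAdmissible_odd d p

/-- **The middle Betti number of a smooth EVEN-dimensional hypersurface in closed form**: for a nonsingular form `F` of
degree `d ≥ 1` in `2r + 2` variables (`r ≥ 1`), `d · b₂ᵣ(X_F) = (d−1)^{2r+2} + (d−1) + d`, i.e.
`b₂ᵣ = ((d−1)^{2r+2} + (d−1))/d + 1`. [cite: EisenbudHarris2016, Example 5.24] [cite: Shioda1979HodgeFermat, §1 (1.3)–(1.4)] -/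
theorem mul_finrank_bettiCohomology_middle_hypersurface_even {d : ℕ} [NeZero d] {r : ℕ} (hr : 1 ≤ r)
    (F : MvPolynomial (Fin (2 * r + 2)) ℂ) (hF : F.IsHomogeneous d)
    (hFns : SmoothHypersurface.IsNonsingularForm ℂ F) :
    d * Module.finrank ℚ (bettiCohomology (SmoothHypersurface.hypersurface F) (2 * r)) =
      (d - 1) ^ (2 * r + 2) + (d - 1) + d := by
  rw [finrank_bettiCohomology_middle_hypersurface_even hr F hF hFns, Nat.mul_add, Nat.mul_one,
    mul_card_fermatAdmissible_even d r]

end Literature.AlgebraicGeometry.HodgeTheory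

end
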